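import Summits.QuantumFields.YangMills.Theorems.LogConcaveChartTransportRemainderDeriv
import Mathlib.Analysis.Matrix.Order

/-!
# Route `LogConcaveChart` — toolkit for the support item `TransportCovarianceTransfer`
(stmt-QuantumFields-23668, child of the transport split of crux `QuadraticCovarianceComparison`,
stmt-QuantumFields-26240): **the `H₀^{1/2}` frame (linear algebra and calculus of the conjugation)**

The item is stated for a general positive definite `H₀`; the analytic estimates were proved in the
isotropic frame.  The reduction is the change of variables `y = P x` with `P = H₀^{1/2}` (symmetric,
invertible, `P² = H₀`): the map becomes `T' y = P T(P⁻¹ y)`, the observables `H ↦ P⁻¹ H P⁻¹`,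
`b ↦ P⁻¹ b`, and `H₀`-norms become Euclidean norms.  This file provides

* `exists_symm_sqrt` — a real positive definite matrix has a symmetric invertible square root
  (Mathlib's `CFC.sqrt` under the `MatrixOrder` scope);
* the algebra of the frame: `P⁻¹ P = 1`, `(P v)·(P w) = vᵀ P² w`, the quadratic observable and the
  `rC / rV` trace and dot-product identities under conjugation;
* the calculus of `T'`: `ContDiff`, the chain-rule formula for `fderiv`, and the transfer of the two
  `H₀`-metric hypotheses (`‖DT − I‖_{H₀} ≤ δ`, `T − id` `δ`-Lipschitz in `H₀`) to Euclidean form.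

HONEST SCOPE. Helper lemmas toward ONE support item of a sub-line; nothing here proves
`TransportCovarianceTransfer`, `QuadraticCovarianceComparison`, the `LogConcaveChart` thesis, rung R2a
(`BalabanLadder.NT`) or any summit statement; the Yang–Mills mass gap is NOT proved.  Filed by
ideator seat ym-idea-8 (generation 8, lens «dual» = transport side).
-/

namespace Summit.QuantumFields.YangMills.Cruxes.TransportCovarianceTransfer

open Matrix

variable {n : ℕ}

section Sqrt

open scoped MatrixOrder ComplexOrder

/-- A real positive definite matrix has a symmetric square root with nonzero determinant
(`P = H₀^{1/2}` via the continuous functional calculus). [folklore] -/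
theorem exists_symm_sqrt {H₀ : Matrix (Fin n) (Fin n) ℝ} (hH : H₀.PosDef) :
    ∃ P : Matrix (Fin n) (Fin n) ℝ, P.IsSymm ∧ P.det ≠ 0 ∧ P * P = H₀ := by
  have hsq : CFC.sqrt H₀ * CFC.sqrt H₀ = H₀ := CFC.sqrt_mul_sqrt_self H₀ hH.posSemidef.nonneg
  refine ⟨CFC.sqrt H₀, ?_, ?_, hsq⟩
  · have h : (CFC.sqrt H₀).PosSemidef := Matrix.nonneg_iff_posSemidef.mp (CFC.sqrt_nonneg H₀)
    exact Matrix.isHermitian_iff_isSymm.mp h.isHermitian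
  · intro h0
    have h := congrArg Matrix.det hsq
    rw [Matrix.det_mul, h0, mul_zero] at h
    exact hH.det_pos.ne' h.symm

end Sqrt

/-! ## Algebra of the frame -/

/-- `P⁻¹ P = 1` for `det P ≠ 0`. [folklore] -/
theorem inv_mul_of_det_ne_zero {P : Matrix (Fin n) (Fin n) ℝ} (hP : P.det ≠ 0) : P⁻¹ * P = 1 :=
  Matrix.nonsing_inv_mul P (isUnit_iff_ne_zero.mpr hP)

/-- `P P⁻¹ = 1` for `det P ≠ 0`. [folklore] -/
theorem mul_inv_of_det_ne_zero {P : Matrix (Fin n) (Fin n) ℝ} (hP : P.det ≠ 0) : P * P⁻¹ = 1 :=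
  Matrix.mul_nonsing_inv P (isUnit_iff_ne_zero.mpr hP)

/-- `P⁻¹ (P x) = x`. [folklore] -/
theorem inv_mulVec_mulVec {P : Matrix (Fin n) (Fin n) ℝ} (hP : P.det ≠ 0) (x : Fin n → ℝ) :
    P⁻¹ *ᵥ (P *ᵥ x) = x := by
  rw [Matrix.mulVec_mulVec, inv_mul_of_det_ne_zero hP, Matrix.one_mulVec]

/-- `P (P⁻¹ y) = y`. [folklore] -/
theorem mulVec_inv_mulVec {P : Matrix (Fin n) (Fin n) ℝ} (hP : P.det ≠ 0) (y : Fin n → ℝ) :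
    P *ᵥ (P⁻¹ *ᵥ y) = y := by
  rw [Matrix.mulVec_mulVec, mul_inv_of_det_ne_zero hP, Matrix.one_mulVec]

/-- The inverse of a symmetric matrix is symmetric. [folklore] -/
theorem isSymm_inv {P : Matrix (Fin n) (Fin n) ℝ} (hPs : P.IsSymm) : P⁻¹.IsSymm := by
  unfold Matrix.IsSymm
  rw [Matrix.transpose_nonsing_inv, hPs.eq]

/-- `(P v)·(P w) = vᵀ (P P) w` for symmetric `P`. [folklore] -/
theorem mulVec_dotProduct_mulVec {P : Matrix (Fin n) (Fin n) ℝ} (hPs : P.IsSymm)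
    (v w : Fin n → ℝ) : P *ᵥ v ⬝ᵥ P *ᵥ w = v ⬝ᵥ (P * P) *ᵥ w := by
  rw [← Matrix.mulVec_mulVec, dotProduct_mulVec_of_isSymm hPs v (P *ᵥ w)]

/-- `Q H Q` is symmetric when `Q` and `H` are. [folklore] -/
theorem isSymm_conj {Q H : Matrix (Fin n) (Fin n) ℝ} (hQ : Q.IsSymm) (hH : H.IsSymm) :
    (Q * H * Q).IsSymm := by
  unfold Matrix.IsSymm
  rw [Matrix.transpose_mul, Matrix.transpose_mul, hQ.eq, hH.eq, Matrix.mul_assoc]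

/-- The quadratic observable in the frame: `q_{QHQ, Qb}(z) = q_{H,b}(Q z)` for symmetric `Q`.
[folklore] -/
theorem quadObs_conj {Q : Matrix (Fin n) (Fin n) ℝ} (hQ : Q.IsSymm) (H : Matrix (Fin n) (Fin n) ℝ)
    (b z : Fin n → ℝ) :
    z ⬝ᵥ (Q * H * Q) *ᵥ z + (Q *ᵥ b) ⬝ᵥ z = (Q *ᵥ z) ⬝ᵥ H *ᵥ (Q *ᵥ z) + b ⬝ᵥ (Q *ᵥ z) := by
  rw [← Matrix.mulVec_mulVec, ← Matrix.mulVec_mulVec, dotProduct_mulVec_of_isSymm hQ z,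
    dotProduct_mulVec_of_isSymm hQ b z]

/-- Trace identity of the frame: `tr((Q H_f Q)(Q H_g Q)) = tr(S H_f S H_g)` with `S = Q Q`.
[folklore] -/
theorem trace_conj_mul_conj (Q Hf Hg S : Matrix (Fin n) (Fin n) ℝ) (hS : Q * Q = S) :
    ((Q * Hf * Q) * (Q * Hg * Q)).trace = (S * Hf * S * Hg).trace := by
  rw [← hS, show (Q * Hf * Q) * (Q * Hg * Q) = Q * (Hf * Q * Q * Hg * Q) by
      simp only [Matrix.mul_assoc], Matrix.trace_mul_comm,
    show Q * Q * Hf * (Q * Q) * Hg = (Q * Q) * (Hf * Q * Q * Hg) by simp only [Matrix.mul_assoc],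
    Matrix.trace_mul_comm (Q * Q),
    show Hf * Q * Q * Hg * Q * Q = (Hf * Q * Q * Hg) * (Q * Q) by simp only [Matrix.mul_assoc]]

/-- Dot-product identity of the frame: `(Q b)·(Q c) = bᵀ S c` with `S = Q Q`, `Q` symmetric.
[folklore] -/
theorem conj_dotProduct_conj {Q S : Matrix (Fin n) (Fin n) ℝ} (hQ : Q.IsSymm) (hS : Q * Q = S)
    (b c : Fin n → ℝ) : (Q *ᵥ b) ⬝ᵥ (Q *ᵥ c) = b ⬝ᵥ S *ᵥ c := by
  rw [mulVec_dotProduct_mulVec hQ, hS]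

/-! ## Calculus of the conjugated map `T' y = P T (Q y)` -/

/-- Chain rule for the conjugated map. [folklore] -/
theorem hasFDerivAt_conj {T : (Fin n → ℝ) → (Fin n → ℝ)} (hT : ContDiff ℝ 1 T)
    (P Q : Matrix (Fin n) (Fin n) ℝ) (y : Fin n → ℝ) :
    HasFDerivAt (fun y => P *ᵥ T (Q *ᵥ y))
      ((Matrix.mulVecLin P).toContinuousLinearMap.comp
        ((fderiv ℝ T (Q *ᵥ y)).comp (Matrix.mulVecLin Q).toContinuousLinearMap)) y := by
  have hTd : HasFDerivAt T (fderiv ℝ T (Q *ᵥ y)) (Q *ᵥ y) :=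
    ((hT.differentiable one_ne_zero) _).hasFDerivAt
  have h1 : HasFDerivAt (fun y => T (Q *ᵥ y))
      ((fderiv ℝ T (Q *ᵥ y)).comp (Matrix.mulVecLin Q).toContinuousLinearMap) y :=
    hTd.comp y (Matrix.mulVecLin Q).toContinuousLinearMap.hasFDerivAt
  exact (Matrix.mulVecLin P).toContinuousLinearMap.hasFDerivAt.comp y h1

/-- `D(P T Q)(y) u = P · DT(Q y)(Q u)`. [folklore] -/
theorem fderiv_conj {T : (Fin n → ℝ) → (Fin n → ℝ)} (hT : ContDiff ℝ 1 T)
    (P Q : Matrix (Fin n) (Fin n) ℝ) (y u : Fin n → ℝ) :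
    fderiv ℝ (fun y => P *ᵥ T (Q *ᵥ y)) y u = P *ᵥ fderiv ℝ T (Q *ᵥ y) (Q *ᵥ u) := by
  rw [(hasFDerivAt_conj hT P Q y).fderiv]
  rfl

/-- The conjugated map is `C¹`. [folklore] -/
theorem contDiff_conj {T : (Fin n → ℝ) → (Fin n → ℝ)} (hT : ContDiff ℝ 1 T)
    (P Q : Matrix (Fin n) (Fin n) ℝ) : ContDiff ℝ 1 fun y => P *ᵥ T (Q *ᵥ y) :=
  (Matrix.mulVecLin P).toContinuousLinearMap.contDiff.comp
    (hT.comp (Matrix.mulVecLin Q).toContinuousLinearMap.contDiff)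

/-- The conjugated map is continuous. [folklore] -/
theorem continuous_conj {T : (Fin n → ℝ) → (Fin n → ℝ)} (hT : Continuous T)
    (P Q : Matrix (Fin n) (Fin n) ℝ) : Continuous fun y => P *ᵥ T (Q *ᵥ y) :=
  (Matrix.mulVecLin P).toContinuousLinearMap.continuous.comp
    (hT.comp (Matrix.mulVecLin Q).toContinuousLinearMap.continuous)

/-- Transfer of the derivative pinching `‖DT − I‖_{H₀} ≤ δ` to the Euclidean frame
`T' = P T P⁻¹`, `P² = H₀`, `P` symmetric invertible. [folklore] -/
theorem fderiv_conj_pinch {δ : ℝ} {H₀ P : Matrix (Fin n) (Fin n) ℝ} (hPs : P.IsSymm)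
    (hP : P.det ≠ 0) (hPP : P * P = H₀) {T : (Fin n → ℝ) → (Fin n → ℝ)} (hT : ContDiff ℝ 1 T)
    (hD : ∀ x u : Fin n → ℝ,
      (fderiv ℝ T x u - u) ⬝ᵥ H₀ *ᵥ (fderiv ℝ T x u - u) ≤ δ ^ 2 * (u ⬝ᵥ H₀ *ᵥ u))
    (y u : Fin n → ℝ) :
    (fderiv ℝ (fun y => P *ᵥ T (P⁻¹ *ᵥ y)) y u - u) ⬝ᵥ
        (fderiv ℝ (fun y => P *ᵥ T (P⁻¹ *ᵥ y)) y u - u) ≤ δ ^ 2 * (u ⬝ᵥ u) := by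
  rw [fderiv_conj hT]
  have hu : u = P *ᵥ (P⁻¹ *ᵥ u) := (mulVec_inv_mulVec hP u).symm
  have e : P *ᵥ fderiv ℝ T (P⁻¹ *ᵥ y) (P⁻¹ *ᵥ u) - u =
      P *ᵥ (fderiv ℝ T (P⁻¹ *ᵥ y) (P⁻¹ *ᵥ u) - P⁻¹ *ᵥ u) := by
    rw [Matrix.mulVec_sub, ← hu]
  rw [e, mulVec_dotProduct_mulVec hPs, hPP]
  have h := hD (P⁻¹ *ᵥ y) (P⁻¹ *ᵥ u)
  rwa [← hPP, ← mulVec_dotProduct_mulVec hPs (P⁻¹ *ᵥ u), ← hu, hPP] at h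

/-- Transfer of the Lipschitz pinching of `T − id` in the `H₀`-metric to the Euclidean frame.
[folklore] -/
theorem lipschitz_conj_pinch {δ : ℝ} {H₀ P : Matrix (Fin n) (Fin n) ℝ} (hPs : P.IsSymm)
    (hP : P.det ≠ 0) (hPP : P * P = H₀) (T : (Fin n → ℝ) → (Fin n → ℝ))
    (hLip : ∀ x y : Fin n → ℝ, (T x - T y - (x - y)) ⬝ᵥ H₀ *ᵥ (T x - T y - (x - y)) ≤
      δ ^ 2 * ((x - y) ⬝ᵥ H₀ *ᵥ (x - y)))
    (y₁ y₂ : Fin n → ℝ) :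
    (P *ᵥ T (P⁻¹ *ᵥ y₁) - P *ᵥ T (P⁻¹ *ᵥ y₂) - (y₁ - y₂)) ⬝ᵥ
        (P *ᵥ T (P⁻¹ *ᵥ y₁) - P *ᵥ T (P⁻¹ *ᵥ y₂) - (y₁ - y₂)) ≤ δ ^ 2 * ((y₁ - y₂) ⬝ᵥ (y₁ - y₂)) := by
  have hy : y₁ - y₂ = P *ᵥ (P⁻¹ *ᵥ y₁ - P⁻¹ *ᵥ y₂) := by
    rw [Matrix.mulVec_sub, mulVec_inv_mulVec hP, mulVec_inv_mulVec hP]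
  have e : P *ᵥ T (P⁻¹ *ᵥ y₁) - P *ᵥ T (P⁻¹ *ᵥ y₂) - (y₁ - y₂) =
      P *ᵥ (T (P⁻¹ *ᵥ y₁) - T (P⁻¹ *ᵥ y₂) - (P⁻¹ *ᵥ y₁ - P⁻¹ *ᵥ y₂)) := by
    simp only [Matrix.mulVec_sub, mulVec_inv_mulVec hP]
  rw [e, mulVec_dotProduct_mulVec hPs, hPP]
  have h := hLip (P⁻¹ *ᵥ y₁) (P⁻¹ *ᵥ y₂)
  rwa [← hPP, ← mulVec_dotProduct_mulVec hPs (P⁻¹ *ᵥ y₁ - P⁻¹ *ᵥ y₂), ← hy, hPP] at h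

end Summit.QuantumFields.YangMills.Cruxes.TransportCovarianceTransfer
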